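import Literature.Analysis.FluidPDE.PineauVicolPressure
import HarnessLib

/-!
# Pineau–Vicol 2026, Lemma 8.1 (proof): the slice derivative `∂ₛ∇ᵏU` read off the profile equation, EVERY order `k`

Analysis/FluidPDE proofs file (theorems only; **no definitions, no named facts**), companion of
`PineauVicolRDSSLargeAlpha` (which holds the orders `k = 0, 1` of the same display in the
nested-`fderiv` shape, the third display and the Poincaré-in-`s` step) in the programme around
B. Pineau, V. Vicol, *On rotated backwards self-similar solutions of the incompressible 3D
Navier–Stokes equations*, arXiv:2607.09619 (2026), §8. HONEST FRAMING: a transcription, with proof,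
of one line of a printed proof about hypothetical profiles; nothing here bears on Navier–Stokes
regularity.

## The source, as printed (Lemma 8.1, proof, p. 28)

"By the same argument, one can deduce the bounds `|∇ᵏ_yU(y,s)| ≤ C_{U,k}(1+|y|)^{−(k+1)}`,
`|∇ᵏ_yP(y,s)| ≤ C_{P,k}(1+|y|)^{−(2−σ+k)}`, `k ≥ 0`, (8.3) for all `(y,s) ∈ ℝ³ × [0,S]`, uniformly
in `α`. Using these bounds, we deduce from the equation (1.14a) the bound
`|∂ₛ∇ᵏU(y,s)| ≤ C_{U,s}(1+|α|)(1+|y|)^{−(k+1)}`, `k ∈ {0,1,2,3}`."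
Here (1.14a) (p. 7) is the profile equation `∂ₛU + α(JU − (Jy·∇)U) + ½U + ½(y·∇)U − ΔU + (U·∇)U + ∇P = 0`.

## What is proved

`PineauVicol2026.norm_iteratedFDeriv_sliceDeriv_le_of_slice_equation (k : ℕ)`: on one time slice,
with `F = ∂ₛU(·,s)`, `U, P ∈ C^∞`, the slice equation in the tree's form
`α𝓡U + ½U + ½DU[y] − ΔU + (U·∇)U + ∇P + F = 0` (`𝓡U = JU − DU[Jy]`, as in
`PineauVicolRDSSLargeAlpha`), (8.3) for `U` up to order `k + 2` in the product form
`(1+|y|)^{j+1}‖DʲU(y)‖ ≤ C` and (8.3) for `P` at order `k + 1` in the (weaker than printed) form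
`(1+|y|)^{k+1}‖D^{k+1}P(y)‖ ≤ C_P`:
`‖DᵏF(y)‖ ≤ (1+|α|)((2ᵏ+4)C + 2ᵏC² + C_P)(1+|y|)^{−(k+1)}` for EVERY `k` — the printed display with
an explicit constant (`Dᵏ = iteratedFDeriv ℝ k`). Term by term: `Dᵏ(JU) = J∘DᵏU`;
`Dᵏ(DU[Jy])`, `Dᵏ(DU[y])` by Leibniz for the evaluation pairing with at most one derivative on the
linear factor; `‖Dᵏ(ΔU)‖ ≤ 3‖D^{k+2}U‖`; `Dᵏ(DU[U])` by Leibniz; `‖Dᵏ(∇P)‖ ≤ ‖D^{k+1}P‖`. With the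
tree's `PineauVicol2026.exists_bound_norm_iteratedFDeriv_pressurePotential_decay` ((8.3) for
`P = Q[U]` at every order, `PineauVicolPressureDerivativesDecay`) the pressure hypothesis is itself a
consequence of (8.3) for `U`.

## References

* B. Pineau, V. Vicol, arXiv:2607.09619 (2026): Lemma 8.1 and its proof (p. 28); (1.14a) (p. 7);
  Lemma 2.1 (2.1)–(2.2) (p. 9). [PineauVicol2026]
-/

noncomputable section

open MeasureTheory Set Filter Metric Topology InnerProductSpace Function
open scoped RealInnerProductSpace Laplacian ContDiff ENNReal

namespace Literature.Analysis.FluidPDE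

namespace PineauVicol2026

-- nested operator types
set_option maxSynthPendingDepth 3

/-! ### Iterated derivatives of the linear pieces of (1.14a) -/

/-- `‖D⁰L(y)‖ ≤ ‖L‖ |y|` for a continuous linear map `L` read as a function. [folklore] -/
private theorem norm_iteratedFDeriv_zero_clm_le (L : EuclideanSpace ℝ (Fin 3) →L[ℝ] EuclideanSpace ℝ (Fin 3))
    (y : EuclideanSpace ℝ (Fin 3)) : ‖iteratedFDeriv ℝ 0 (fun z => L z) y‖ ≤ ‖L‖ * ‖y‖ := by
  rw [norm_iteratedFDeriv_zero]
  exact L.le_opNorm y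

/-- `‖D¹L(y)‖ ≤ ‖L‖` for a continuous linear map `L` read as a function. [folklore] -/
private theorem norm_iteratedFDeriv_one_clm_le (L : EuclideanSpace ℝ (Fin 3) →L[ℝ] EuclideanSpace ℝ (Fin 3))
    (y : EuclideanSpace ℝ (Fin 3)) : ‖iteratedFDeriv ℝ 1 (fun z => L z) y‖ ≤ ‖L‖ := by
  rw [← norm_iteratedFDeriv_fderiv, norm_iteratedFDeriv_zero]
  have : fderiv ℝ (fun z => L z) y = L := L.fderiv
  rw [this]

/-- `D^{m+2}L = 0` for a continuous linear map `L` read as a function. [folklore] -/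
private theorem norm_iteratedFDeriv_add_two_clm (L : EuclideanSpace ℝ (Fin 3) →L[ℝ] EuclideanSpace ℝ (Fin 3))
    (m : ℕ) (y : EuclideanSpace ℝ (Fin 3)) : ‖iteratedFDeriv ℝ (m + 2) (fun z => L z) y‖ = 0 := by
  rw [← norm_iteratedFDeriv_fderiv, ← norm_iteratedFDeriv_fderiv]
  have h1 : fderiv ℝ (fun z => L z) = fun _ => L := by funext z; exact L.fderiv
  have h2 : fderiv ℝ (fderiv ℝ (fun z => L z)) = fun _ => 0 := by
    rw [h1]; funext z; exact fderiv_const_apply L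
  rw [h2, iteratedFDeriv_fun_zero]
  simp

/-- **`Dᵏ` of `y ↦ DU(y)[L y]`** for a continuous linear `L` (the pieces `(Jy·∇)U`, `(y·∇)U` of
(1.14a)): if `‖DʲU(y)‖ ≤ C/(1+|y|)^{j+1}` for `j = k, k+1` then
`‖Dᵏ(DU[L·])(y)‖ ≤ 2ᵏ ‖L‖ C/(1+|y|)^{k+1}` (Leibniz; only the terms with at most one derivative
on `L` survive: `‖D^{k+1}U‖ ‖L‖|y| + k‖DᵏU‖‖L‖`). [folklore] -/
private theorem norm_iteratedFDeriv_fderiv_apply_clm_le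
    {U : EuclideanSpace ℝ (Fin 3) → EuclideanSpace ℝ (Fin 3)} (hU : ContDiff ℝ ∞ U)
    (L : EuclideanSpace ℝ (Fin 3) →L[ℝ] EuclideanSpace ℝ (Fin 3)) (k : ℕ) {C : ℝ}
    (y : EuclideanSpace ℝ (Fin 3))
    (hk : ‖iteratedFDeriv ℝ k U y‖ ≤ C / (1 + ‖y‖) ^ (k + 1))
    (hk1 : ‖iteratedFDeriv ℝ (k + 1) U y‖ ≤ C / (1 + ‖y‖) ^ (k + 2)) :
    ‖iteratedFDeriv ℝ k (fun z => fderiv ℝ U z (L z)) y‖ ≤ 2 ^ k * ‖L‖ * C / (1 + ‖y‖) ^ (k + 1) := by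
  have hw : 0 < 1 + ‖y‖ := by positivity
  have hC0 : 0 ≤ C := by
    have h := (norm_nonneg _).trans hk
    rw [le_div_iff₀ (by positivity), zero_mul] at h
    exact h
  have hDU : ContDiff ℝ ∞ (fderiv ℝ U) := hU.fderiv_right (m := ∞) le_rfl
  have hL : ContDiff ℝ ∞ (fun z : EuclideanSpace ℝ (Fin 3) => L z) := L.contDiff
  have h := norm_iteratedFDeriv_clm_apply hDU hL y (n := k) (by exact_mod_cast le_top)
  refine h.trans ?_
  -- termwise: `‖Dⁱ(DU)‖ ‖D^{k-i}L‖ ≤ ‖L‖ C/(1+|y|)^{k+1}`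
  have hterm : ∀ i ∈ Finset.range (k + 1),
      (k.choose i : ℝ) * ‖iteratedFDeriv ℝ i (fderiv ℝ U) y‖ * ‖iteratedFDeriv ℝ (k - i) (fun z => L z) y‖ ≤
        (k.choose i : ℝ) * (‖L‖ * C / (1 + ‖y‖) ^ (k + 1)) := by
    intro i hi
    have hik : i ≤ k := Nat.lt_succ_iff.1 (Finset.mem_range.1 hi)
    rw [mul_assoc]
    refine mul_le_mul_of_nonneg_left ?_ (Nat.cast_nonneg _)
    rw [norm_iteratedFDeriv_fderiv]
    rcases Nat.lt_or_ge (k - i) 2 with hlt | hge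
    · interval_cases hki : (k - i)
      · -- `i = k`
        have hi' : i = k := by omega
        subst hi'
        calc ‖iteratedFDeriv ℝ (i + 1) U y‖ * ‖iteratedFDeriv ℝ 0 (fun z => L z) y‖
            ≤ C / (1 + ‖y‖) ^ (i + 2) * (‖L‖ * ‖y‖) :=
              mul_le_mul hk1 (norm_iteratedFDeriv_zero_clm_le L y) (norm_nonneg _) (by positivity)
          _ ≤ ‖L‖ * C / (1 + ‖y‖) ^ (i + 1) := by
              rw [div_mul_eq_mul_div, div_le_div_iff₀ (by positivity) (by positivity)]
              have hy1 : ‖y‖ ≤ 1 + ‖y‖ := by linarith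
              have : C * (‖L‖ * ‖y‖) * (1 + ‖y‖) ^ (i + 1) ≤ C * (‖L‖ * (1 + ‖y‖)) * (1 + ‖y‖) ^ (i + 1) := by
                gcongr
              refine this.trans (le_of_eq ?_)
              ring
      · -- `i = k - 1`
        have hi' : i + 1 = k := by omega
        rw [hi']
        calc ‖iteratedFDeriv ℝ k U y‖ * ‖iteratedFDeriv ℝ 1 (fun z => L z) y‖
            ≤ C / (1 + ‖y‖) ^ (k + 1) * ‖L‖ :=
              mul_le_mul hk (norm_iteratedFDeriv_one_clm_le L y) (norm_nonneg _) (by positivity)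
          _ = ‖L‖ * C / (1 + ‖y‖) ^ (k + 1) := by ring
    · obtain ⟨m, hm⟩ : ∃ m, k - i = m + 2 := ⟨k - i - 2, by omega⟩
      rw [hm, norm_iteratedFDeriv_add_two_clm L m y, mul_zero]
      positivity
  refine (Finset.sum_le_sum hterm).trans ?_
  rw [← Finset.sum_mul]
  have hsum : ∑ i ∈ Finset.range (k + 1), (k.choose i : ℝ) = 2 ^ k := by
    have := Nat.sum_range_choose k
    exact_mod_cast this
  rw [hsum]
  exact le_of_eq (by ring)

/-- `D²φ(x)[v, v] = D(Dφ · v)(x) v`. [folklore] -/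
private theorem iteratedFDeriv_two_apply_self' {F : Type*} [NormedAddCommGroup F] [NormedSpace ℝ F]
    {φ : EuclideanSpace ℝ (Fin 3) → F} (hφ : ContDiff ℝ 2 φ) (x v : EuclideanSpace ℝ (Fin 3)) :
    iteratedFDeriv ℝ 2 φ x ![v, v] = fderiv ℝ (fun y => fderiv ℝ φ y v) x v := by
  have hd : DifferentiableAt ℝ (fderiv ℝ φ) x :=
    ((hφ.fderiv_right (m := 1) le_rfl).differentiable one_ne_zero) x
  rw [iteratedFDeriv_two_apply, fderiv_clm_apply hd (differentiableAt_const v)]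
  simp

/-- **Iterated derivatives of the Laplacian on `ℝ³`**: `‖Dᵏ(Δf)(x)‖ ≤ 3 ‖Dᵏ⁺²f(x)‖` for smooth `f`
(frame expansion `Δf = Σᵢ ∂ᵢ∂ᵢf`; twin of the tree's `norm_iteratedFDeriv_laplacian_le`, which is
outside this file's import cone). [folklore] -/
private theorem norm_iteratedFDeriv_laplacian_le_three {F : Type*} [NormedAddCommGroup F] [NormedSpace ℝ F]
    {f : EuclideanSpace ℝ (Fin 3) → F} (hf : ContDiff ℝ ∞ f) (k : ℕ) (x : EuclideanSpace ℝ (Fin 3)) :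
    ‖iteratedFDeriv ℝ k (Δ f) x‖ ≤ 3 * ‖iteratedFDeriv ℝ (k + 2) f x‖ := by
  set b := stdOrthonormalBasis ℝ (EuclideanSpace ℝ (Fin 3)) with hb
  have hkᵢ : ∀ i, ContDiff ℝ ∞ fun y => fderiv ℝ f y (b i) := fun i =>
    (hf.fderiv_right (m := ∞) (by exact_mod_cast le_rfl)).clm_apply contDiff_const
  have hgᵢ : ∀ i, ContDiff ℝ ∞ fun y => fderiv ℝ (fun z => fderiv ℝ f z (b i)) y (b i) := fun i =>
    ((hkᵢ i).fderiv_right (m := ∞) (by exact_mod_cast le_rfl)).clm_apply contDiff_const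
  have hΔ : Δ f = fun y => ∑ i, fderiv ℝ (fun z => fderiv ℝ f z (b i)) y (b i) := by
    rw [laplacian_eq_iteratedFDeriv_orthonormalBasis f b]
    funext y
    exact Finset.sum_congr rfl fun i _ => iteratedFDeriv_two_apply_self' (contDiff_infty.1 hf 2) y (b i)
  rw [hΔ, iteratedFDeriv_fun_sum_apply fun i _ => (hgᵢ i).contDiffAt.of_le (by exact_mod_cast le_top)]
  have hcard : Fintype.card (Fin (Module.finrank ℝ (EuclideanSpace ℝ (Fin 3)))) = 3 := by
    rw [Fintype.card_fin, finrank_euclideanSpace_fin]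
  calc ‖∑ i, iteratedFDeriv ℝ k (fun y => fderiv ℝ (fun z => fderiv ℝ f z (b i)) y (b i)) x‖
      ≤ ∑ i, ‖iteratedFDeriv ℝ k (fun y => fderiv ℝ (fun z => fderiv ℝ f z (b i)) y (b i)) x‖ :=
        norm_sum_le _ _
    _ ≤ ∑ _i : Fin (Module.finrank ℝ (EuclideanSpace ℝ (Fin 3))), ‖iteratedFDeriv ℝ (k + 2) f x‖ :=
        Finset.sum_le_sum fun i _ => by
          have h1 := norm_iteratedFDeriv_clm_apply_const
            (((hkᵢ i).fderiv_right (m := ∞) (by exact_mod_cast le_rfl)).contDiffAt) (c := b i)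
            (n := k) (x := x) (by exact_mod_cast le_top)
          rw [b.orthonormal.1 i, one_mul, norm_iteratedFDeriv_fderiv] at h1
          have h2 := norm_iteratedFDeriv_clm_apply_const
            ((hf.fderiv_right (m := ∞) (by exact_mod_cast le_rfl)).contDiffAt) (c := b i)
            (n := k + 1) (x := x) (by exact_mod_cast le_top)
          rw [b.orthonormal.1 i, one_mul, norm_iteratedFDeriv_fderiv] at h2
          exact h1.trans h2
    _ = 3 * ‖iteratedFDeriv ℝ (k + 2) f x‖ := by
        rw [Finset.sum_const, Finset.card_univ, hcard]; simp

/-- **`Dᵏ` of the convective term** `y ↦ DU(y)[U(y)]` under the decay class: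
`‖Dᵏ((U·∇)U)(y)‖ ≤ 2ᵏ C²/(1+|y|)^{k+3}` from `(1+|y|)^{j+1}‖DʲU(y)‖ ≤ C`, `j ≤ k+1` (Leibniz).
[folklore] -/
private theorem norm_iteratedFDeriv_convect_le
    {U : EuclideanSpace ℝ (Fin 3) → EuclideanSpace ℝ (Fin 3)} (hU : ContDiff ℝ ∞ U) (k : ℕ) {C : ℝ}
    (y : EuclideanSpace ℝ (Fin 3))
    (hC : ∀ j ≤ k + 1, (1 + ‖y‖) ^ (j + 1) * ‖iteratedFDeriv ℝ j U y‖ ≤ C) :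
    ‖iteratedFDeriv ℝ k (fun z => fderiv ℝ U z (U z)) y‖ ≤ 2 ^ k * C ^ 2 / (1 + ‖y‖) ^ (k + 3) := by
  have hw : 0 < 1 + ‖y‖ := by positivity
  have hC0 : 0 ≤ C := le_trans (by positivity) (hC 0 (by omega))
  have hDU : ContDiff ℝ ∞ (fderiv ℝ U) := hU.fderiv_right (m := ∞) le_rfl
  have hd : ∀ j ≤ k + 1, ‖iteratedFDeriv ℝ j U y‖ ≤ C / (1 + ‖y‖) ^ (j + 1) := by
    intro j hj
    rw [le_div_iff₀ (by positivity), mul_comm]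
    exact hC j hj
  refine (norm_iteratedFDeriv_clm_apply hDU hU y (n := k) (by exact_mod_cast le_top)).trans ?_
  have hterm : ∀ i ∈ Finset.range (k + 1),
      (k.choose i : ℝ) * ‖iteratedFDeriv ℝ i (fderiv ℝ U) y‖ * ‖iteratedFDeriv ℝ (k - i) U y‖ ≤
        (k.choose i : ℝ) * (C ^ 2 / (1 + ‖y‖) ^ (k + 3)) := by
    intro i hi
    have hik : i ≤ k := Nat.lt_succ_iff.1 (Finset.mem_range.1 hi)
    rw [mul_assoc]
    refine mul_le_mul_of_nonneg_left ?_ (Nat.cast_nonneg _)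
    rw [norm_iteratedFDeriv_fderiv]
    calc ‖iteratedFDeriv ℝ (i + 1) U y‖ * ‖iteratedFDeriv ℝ (k - i) U y‖
        ≤ C / (1 + ‖y‖) ^ (i + 2) * (C / (1 + ‖y‖) ^ (k - i + 1)) :=
          mul_le_mul (hd (i + 1) (by omega)) (hd (k - i) (by omega)) (norm_nonneg _) (by positivity)
      _ = C ^ 2 / (1 + ‖y‖) ^ (k + 3) := by
          rw [div_mul_div_comm, ← pow_add]
          have : i + 2 + (k - i + 1) = k + 3 := by omega
          rw [this]; ring
  refine (Finset.sum_le_sum hterm).trans ?_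
  rw [← Finset.sum_mul]
  have hsum : ∑ i ∈ Finset.range (k + 1), (k.choose i : ℝ) = 2 ^ k := by
    have := Nat.sum_range_choose k
    exact_mod_cast this
  rw [hsum]
  exact le_of_eq (by ring)

/-- `‖Dᵏ(∇P)(y)‖ ≤ ‖Dᵏ⁺¹P(y)‖` (the gradient is an isometric image of the derivative). [folklore] -/
private theorem norm_iteratedFDeriv_gradient_le {P : EuclideanSpace ℝ (Fin 3) → ℝ} (hP : ContDiff ℝ ∞ P)
    (k : ℕ) (y : EuclideanSpace ℝ (Fin 3)) :
    ‖iteratedFDeriv ℝ k (gradient P) y‖ ≤ ‖iteratedFDeriv ℝ (k + 1) P y‖ := by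
  have hgrad : gradient P =
      ((InnerProductSpace.toDual ℝ (EuclideanSpace ℝ (Fin 3))).symm :
        StrongDual ℝ (EuclideanSpace ℝ (Fin 3)) →L[ℝ] EuclideanSpace ℝ (Fin 3)) ∘ (fderiv ℝ P) := by
    funext z; rfl
  have hDP : ContDiff ℝ ∞ (fderiv ℝ P) := hP.fderiv_right (m := ∞) le_rfl
  rw [hgrad]
  refine (ContinuousLinearMap.norm_iteratedFDeriv_comp_left _ hDP.contDiffAt (by exact_mod_cast le_top)).trans ?_
  rw [norm_iteratedFDeriv_fderiv]
  have hn : ‖((InnerProductSpace.toDual ℝ (EuclideanSpace ℝ (Fin 3))).symm :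
      StrongDual ℝ (EuclideanSpace ℝ (Fin 3)) →L[ℝ] EuclideanSpace ℝ (Fin 3))‖ ≤ 1 := by
    refine ContinuousLinearMap.opNorm_le_bound _ zero_le_one fun v => ?_
    rw [one_mul]
    exact le_of_eq (LinearIsometryEquiv.norm_map _ _)
  calc _ ≤ 1 * ‖iteratedFDeriv ℝ (k + 1) P y‖ := mul_le_mul_of_nonneg_right hn (norm_nonneg _)
    _ = _ := one_mul _

/-- `Δf ∈ C^∞` for `f ∈ C^∞` (frame expansion). [folklore] -/
private theorem contDiff_laplacian_top' {F : Type*} [NormedAddCommGroup F] [NormedSpace ℝ F]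
    {f : EuclideanSpace ℝ (Fin 3) → F} (hf : ContDiff ℝ ∞ f) : ContDiff ℝ ∞ (Δ f) := by
  set b := stdOrthonormalBasis ℝ (EuclideanSpace ℝ (Fin 3)) with hb
  have hkᵢ : ∀ i, ContDiff ℝ ∞ fun y => fderiv ℝ f y (b i) := fun i =>
    (hf.fderiv_right (m := ∞) (by exact_mod_cast le_rfl)).clm_apply contDiff_const
  have hgᵢ : ∀ i, ContDiff ℝ ∞ fun y => fderiv ℝ (fun z => fderiv ℝ f z (b i)) y (b i) := fun i =>
    ((hkᵢ i).fderiv_right (m := ∞) (by exact_mod_cast le_rfl)).clm_apply contDiff_const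
  have hΔ : Δ f = fun y => ∑ i, fderiv ℝ (fun z => fderiv ℝ f z (b i)) y (b i) := by
    rw [laplacian_eq_iteratedFDeriv_orthonormalBasis f b]
    funext y
    exact Finset.sum_congr rfl fun i _ => iteratedFDeriv_two_apply_self' (contDiff_infty.1 hf 2) y (b i)
  rw [hΔ]
  exact ContDiff.sum fun i _ => hgᵢ i

/-- `‖rotGenL‖ ≤ 1`. [folklore] -/
private theorem norm_rotGenL_le_one_aux : ‖rotGenL‖ ≤ 1 :=
  ContinuousLinearMap.opNorm_le_bound _ zero_le_one fun y => by
    rw [one_mul, rotGenL_apply]; exact norm_rotGen_le y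

/-- **Pineau–Vicol 2026, Lemma 8.1, proof — the slice derivative read off the equation, first
display, EVERY ORDER `k`.** "Using these bounds, we deduce from the equation (1.14a) the bound
`|∂_s∇ᵏU(y, s)| ≤ C_{U,s}(1 + |α|)(1 + |y|)^{−k−1}`, `k ∈ {0,1,2,3}`" (p. 28) — on one time slice and
for every `k ∈ ℕ`: if the smooth profile `U` obeys (8.3) up to order `k + 2`,
`(1+|y|)^{j+1}‖DʲU(y)‖ ≤ C` (`j ≤ k+2`), the smooth pressure obeys (8.3) at order `k + 1` in the form
`(1+|y|)^{k+1}‖D^{k+1}P(y)‖ ≤ C_P` (weaker than the printed `(1+|y|)^{k+3}`), and the slice equation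
(1.14a) `∂_sU + α𝓡U + ½U + ½(y·∇)U − ΔU + (U·∇)U + ∇P = 0` holds with `F = ∂_sU(·, s)`, then
`‖DᵏF(y)‖ ≤ (1 + |α|)((2ᵏ + 4)C + 2ᵏC² + C_P)(1 + |y|)^{−(k+1)}`: `Dᵏ` of each term of (1.14a) —
`Dᵏ(JU) = J∘DᵏU`; `Dᵏ((Jy·∇)U)`, `Dᵏ((y·∇)U)` by Leibniz with at most one derivative on the linear
factor (`≤ 2ᵏC(1+|y|)^{−(k+1)}`); `‖Dᵏ(ΔU)‖ ≤ 3‖D^{k+2}U‖`; `Dᵏ((U·∇)U)` by Leibniz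
(`≤ 2ᵏC²(1+|y|)^{−(k+3)}`); `‖Dᵏ∇P‖ ≤ ‖D^{k+1}P‖`. The orders `k = 0, 1` in the nested-`fderiv`
shape are the tree's `norm_sliceDeriv_le_of_slice_equation` /
`norm_fderiv_sliceDeriv_le_of_slice_equation` (`PineauVicolRDSSLargeAlpha`).
[cite: PineauVicol2026, Lemma 8.1, proof (p. 28); (1.14a) (p. 7)] -/
theorem norm_iteratedFDeriv_sliceDeriv_le_of_slice_equation (k : ℕ)
    {U F : EuclideanSpace ℝ (Fin 3) → EuclideanSpace ℝ (Fin 3)} {P : EuclideanSpace ℝ (Fin 3) → ℝ}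
    {α : ℝ} (hU : ContDiff ℝ ∞ U) (hP : ContDiff ℝ ∞ P) {C CP : ℝ}
    (hC : ∀ j ≤ k + 2, ∀ y, (1 + ‖y‖) ^ (j + 1) * ‖iteratedFDeriv ℝ j U y‖ ≤ C)
    (hCP : ∀ y, (1 + ‖y‖) ^ (k + 1) * ‖iteratedFDeriv ℝ (k + 1) P y‖ ≤ CP)
    (heq : ∀ y, α • (rotGen (U y) - fderiv ℝ U y (rotGen y)) + (1 / 2 : ℝ) • U y +
      (1 / 2 : ℝ) • fderiv ℝ U y y - (Δ U) y + convect U U y + gradient P y + F y = 0)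
    (y : EuclideanSpace ℝ (Fin 3)) :
    ‖iteratedFDeriv ℝ k F y‖ ≤
      (1 + |α|) * ((2 ^ k + 4) * C + 2 ^ k * C ^ 2 + CP) / (1 + ‖y‖) ^ (k + 1) := by
  have hw : 0 < 1 + ‖y‖ := by positivity
  have hwk : 0 < (1 + ‖y‖) ^ (k + 1) := by positivity
  have ha : 0 ≤ |α| := abs_nonneg α
  have hC0 : 0 ≤ C := le_trans (by positivity) (hC 0 (by omega) 0)
  have hCP0 : 0 ≤ CP := le_trans (by positivity) (hCP 0)
  -- pointwise decay at `y`
  have hd : ∀ j ≤ k + 2, ‖iteratedFDeriv ℝ j U y‖ ≤ C / (1 + ‖y‖) ^ (j + 1) := by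
    intro j hj
    rw [le_div_iff₀ (by positivity), mul_comm]
    exact hC j hj y
  -- smoothness of the pieces
  have hDU : ContDiff ℝ ∞ (fderiv ℝ U) := hU.fderiv_right (m := ∞) le_rfl
  set L₁ : EuclideanSpace ℝ (Fin 3) →L[ℝ] EuclideanSpace ℝ (Fin 3) :=
    ContinuousLinearMap.id ℝ (EuclideanSpace ℝ (Fin 3)) with hL₁
  have hg1 : ContDiff ℝ ∞ (fun z => rotGenL (U z)) := rotGenL.contDiff.comp hU
  have hg2 : ContDiff ℝ ∞ (fun z => fderiv ℝ U z (rotGenL z)) := hDU.clm_apply rotGenL.contDiff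
  have hg4 : ContDiff ℝ ∞ (fun z => fderiv ℝ U z (L₁ z)) := hDU.clm_apply L₁.contDiff
  have hg5 : ContDiff ℝ ∞ (Δ U) := contDiff_laplacian_top' hU
  have hg6 : ContDiff ℝ ∞ (fun z => fderiv ℝ U z (U z)) := hDU.clm_apply hU
  have hg7 : ContDiff ℝ ∞ (gradient P) := by
    have h2 : gradient P = fun x => (InnerProductSpace.toDual ℝ (EuclideanSpace ℝ (Fin 3))).symm
        (fderiv ℝ P x) := rfl
    rw [h2]
    exact (InnerProductSpace.toDual ℝ (EuclideanSpace ℝ (Fin 3))).symm.contDiff.comp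
      (hP.fderiv_right (m := ∞) le_rfl)
  -- `F` as minus the sum of the pieces
  set S : EuclideanSpace ℝ (Fin 3) → EuclideanSpace ℝ (Fin 3) :=
    α • ((fun z => rotGenL (U z)) - fun z => fderiv ℝ U z (rotGenL z)) + (1 / 2 : ℝ) • U +
      (1 / 2 : ℝ) • (fun z => fderiv ℝ U z (L₁ z)) - Δ U + (fun z => fderiv ℝ U z (U z)) + gradient P
    with hS
  have hF : F = -S := by
    funext z
    have hz := heq z
    rw [convect_apply] at hz
    rw [Pi.neg_apply, eq_neg_iff_add_eq_zero, ← hz, hS]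
    simp only [Pi.add_apply, Pi.sub_apply, Pi.smul_apply, rotGenL_apply, hL₁,
      ContinuousLinearMap.coe_id', id]
    abel
  -- smoothness at level `k`
  have hk1 : ContDiffAt ℝ k (fun z => rotGenL (U z)) y := hg1.contDiffAt.of_le (by exact_mod_cast le_top)
  have hk2 : ContDiffAt ℝ k (fun z => fderiv ℝ U z (rotGenL z)) y :=
    hg2.contDiffAt.of_le (by exact_mod_cast le_top)
  have hk3 : ContDiffAt ℝ k U y := hU.contDiffAt.of_le (by exact_mod_cast le_top)
  have hk4 : ContDiffAt ℝ k (fun z => fderiv ℝ U z (L₁ z)) y := hg4.contDiffAt.of_le (by exact_mod_cast le_top)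
  have hk5 : ContDiffAt ℝ k (Δ U) y := hg5.contDiffAt.of_le (by exact_mod_cast le_top)
  have hk6 : ContDiffAt ℝ k (fun z => fderiv ℝ U z (U z)) y := hg6.contDiffAt.of_le (by exact_mod_cast le_top)
  have hk7 : ContDiffAt ℝ k (gradient P) y := hg7.contDiffAt.of_le (by exact_mod_cast le_top)
  have hk12 : ContDiffAt ℝ k ((fun z => rotGenL (U z)) - fun z => fderiv ℝ U z (rotGenL z)) y :=
    hk1.sub hk2
  have hkA : ContDiffAt ℝ k (α • ((fun z => rotGenL (U z)) - fun z => fderiv ℝ U z (rotGenL z))) y :=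
    hk12.const_smul α
  have hkB : ContDiffAt ℝ k ((1 / 2 : ℝ) • U) y := hk3.const_smul (1 / 2 : ℝ)
  have hkC : ContDiffAt ℝ k ((1 / 2 : ℝ) • fun z => fderiv ℝ U z (L₁ z)) y := hk4.const_smul (1 / 2 : ℝ)
  have hkAB : ContDiffAt ℝ k (α • ((fun z => rotGenL (U z)) - fun z => fderiv ℝ U z (rotGenL z)) +
      (1 / 2 : ℝ) • U) y := hkA.add hkB
  have hkABC : ContDiffAt ℝ k (α • ((fun z => rotGenL (U z)) - fun z => fderiv ℝ U z (rotGenL z)) +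
      (1 / 2 : ℝ) • U + (1 / 2 : ℝ) • (fun z => fderiv ℝ U z (L₁ z))) y := hkAB.add hkC
  have hkABCD : ContDiffAt ℝ k (α • ((fun z => rotGenL (U z)) - fun z => fderiv ℝ U z (rotGenL z)) +
      (1 / 2 : ℝ) • U + (1 / 2 : ℝ) • (fun z => fderiv ℝ U z (L₁ z)) - Δ U) y := hkABC.sub hk5
  have hkABCDE : ContDiffAt ℝ k (α • ((fun z => rotGenL (U z)) - fun z => fderiv ℝ U z (rotGenL z)) +
      (1 / 2 : ℝ) • U + (1 / 2 : ℝ) • (fun z => fderiv ℝ U z (L₁ z)) - Δ U +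
      (fun z => fderiv ℝ U z (U z))) y := hkABCD.add hk6
  -- the bounds of the pieces
  have b1 : ‖iteratedFDeriv ℝ k (fun z => rotGenL (U z)) y‖ ≤ C / (1 + ‖y‖) ^ (k + 1) := by
    have e : (fun z => rotGenL (U z)) = rotGenL ∘ U := rfl
    rw [e]
    refine (ContinuousLinearMap.norm_iteratedFDeriv_comp_left rotGenL hU.contDiffAt
      (by exact_mod_cast le_top)).trans ?_
    calc ‖rotGenL‖ * ‖iteratedFDeriv ℝ k U y‖ ≤ 1 * (C / (1 + ‖y‖) ^ (k + 1)) :=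
          mul_le_mul norm_rotGenL_le_one_aux (hd k (by omega)) (norm_nonneg _) zero_le_one
      _ = C / (1 + ‖y‖) ^ (k + 1) := one_mul _
  have b2 : ‖iteratedFDeriv ℝ k (fun z => fderiv ℝ U z (rotGenL z)) y‖ ≤ 2 ^ k * C / (1 + ‖y‖) ^ (k + 1) := by
    have h := norm_iteratedFDeriv_fderiv_apply_clm_le hU rotGenL k y (hd k (by omega)) (hd (k + 1) (by omega))
    refine h.trans ?_
    rw [div_le_div_iff_of_pos_right hwk]
    calc 2 ^ k * ‖rotGenL‖ * C ≤ 2 ^ k * 1 * C := by gcongr; exact norm_rotGenL_le_one_aux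
      _ = 2 ^ k * C := by ring
  have b3 : ‖iteratedFDeriv ℝ k U y‖ ≤ C / (1 + ‖y‖) ^ (k + 1) := hd k (by omega)
  have b4 : ‖iteratedFDeriv ℝ k (fun z => fderiv ℝ U z (L₁ z)) y‖ ≤ 2 ^ k * C / (1 + ‖y‖) ^ (k + 1) := by
    have h := norm_iteratedFDeriv_fderiv_apply_clm_le hU L₁ k y (hd k (by omega)) (hd (k + 1) (by omega))
    refine h.trans ?_
    rw [div_le_div_iff_of_pos_right hwk]
    calc 2 ^ k * ‖L₁‖ * C ≤ 2 ^ k * 1 * C := by gcongr; exact ContinuousLinearMap.norm_id_le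
      _ = 2 ^ k * C := by ring
  have b5 : ‖iteratedFDeriv ℝ k (Δ U) y‖ ≤ 3 * C / (1 + ‖y‖) ^ (k + 1) := by
    refine (norm_iteratedFDeriv_laplacian_le_three hU k y).trans ?_
    have h := hd (k + 2) le_rfl
    calc 3 * ‖iteratedFDeriv ℝ (k + 2) U y‖ ≤ 3 * (C / (1 + ‖y‖) ^ (k + 2 + 1)) :=
          mul_le_mul_of_nonneg_left h (by norm_num)
      _ ≤ 3 * (C / (1 + ‖y‖) ^ (k + 1)) := by
          refine mul_le_mul_of_nonneg_left ?_ (by norm_num)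
          exact div_le_div_of_nonneg_left hC0 hwk (pow_le_pow_right₀ (by linarith [norm_nonneg y]) (by omega))
      _ = 3 * C / (1 + ‖y‖) ^ (k + 1) := by ring
  have b6 : ‖iteratedFDeriv ℝ k (fun z => fderiv ℝ U z (U z)) y‖ ≤ 2 ^ k * C ^ 2 / (1 + ‖y‖) ^ (k + 1) := by
    refine (norm_iteratedFDeriv_convect_le hU k y fun j hj => hC j (by omega) y).trans ?_
    exact div_le_div_of_nonneg_left (by positivity) hwk
      (pow_le_pow_right₀ (by linarith [norm_nonneg y]) (by omega))
  have b7 : ‖iteratedFDeriv ℝ k (gradient P) y‖ ≤ CP / (1 + ‖y‖) ^ (k + 1) := by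
    refine (norm_iteratedFDeriv_gradient_le hP k y).trans ?_
    rw [le_div_iff₀ hwk, mul_comm]
    exact hCP y
  -- expand `Dᵏ S`
  have eS : iteratedFDeriv ℝ k S y =
      α • (iteratedFDeriv ℝ k (fun z => rotGenL (U z)) y - iteratedFDeriv ℝ k (fun z => fderiv ℝ U z (rotGenL z)) y) +
        (1 / 2 : ℝ) • iteratedFDeriv ℝ k U y +
        (1 / 2 : ℝ) • iteratedFDeriv ℝ k (fun z => fderiv ℝ U z (L₁ z)) y -
        iteratedFDeriv ℝ k (Δ U) y + iteratedFDeriv ℝ k (fun z => fderiv ℝ U z (U z)) y +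
        iteratedFDeriv ℝ k (gradient P) y := by
    rw [hS, iteratedFDeriv_add_apply hkABCDE hk7, iteratedFDeriv_add_apply hkABCD hk6,
      iteratedFDeriv_sub_apply hkABC hk5, iteratedFDeriv_add_apply hkAB hkC, iteratedFDeriv_add_apply hkA hkB,
      iteratedFDeriv_const_smul_apply hk12, iteratedFDeriv_sub_apply hk1 hk2,
      iteratedFDeriv_const_smul_apply hk3, iteratedFDeriv_const_smul_apply hk4]
  rw [hF, iteratedFDeriv_neg_apply, norm_neg, eS]
  -- triangle inequality
  have hhalf : ‖(1 / 2 : ℝ)‖ = 1 / 2 := by norm_num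
  calc ‖α • (iteratedFDeriv ℝ k (fun z => rotGenL (U z)) y -
            iteratedFDeriv ℝ k (fun z => fderiv ℝ U z (rotGenL z)) y) +
          (1 / 2 : ℝ) • iteratedFDeriv ℝ k U y +
          (1 / 2 : ℝ) • iteratedFDeriv ℝ k (fun z => fderiv ℝ U z (L₁ z)) y -
          iteratedFDeriv ℝ k (Δ U) y + iteratedFDeriv ℝ k (fun z => fderiv ℝ U z (U z)) y +
          iteratedFDeriv ℝ k (gradient P) y‖
      ≤ |α| * (‖iteratedFDeriv ℝ k (fun z => rotGenL (U z)) y‖ +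
            ‖iteratedFDeriv ℝ k (fun z => fderiv ℝ U z (rotGenL z)) y‖) +
          (1 / 2) * ‖iteratedFDeriv ℝ k U y‖ +
          (1 / 2) * ‖iteratedFDeriv ℝ k (fun z => fderiv ℝ U z (L₁ z)) y‖ +
          ‖iteratedFDeriv ℝ k (Δ U) y‖ + ‖iteratedFDeriv ℝ k (fun z => fderiv ℝ U z (U z)) y‖ +
          ‖iteratedFDeriv ℝ k (gradient P) y‖ := by
        refine (norm_add_le _ _).trans (add_le_add ?_ le_rfl)
        refine (norm_add_le _ _).trans (add_le_add ?_ le_rfl)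
        refine (norm_sub_le _ _).trans (add_le_add ?_ le_rfl)
        refine (norm_add_le _ _).trans (add_le_add ?_ ?_)
        · refine (norm_add_le _ _).trans (add_le_add ?_ ?_)
          · rw [norm_smul, Real.norm_eq_abs]
            exact mul_le_mul_of_nonneg_left (norm_sub_le _ _) ha
          · rw [norm_smul, hhalf]
        · rw [norm_smul, hhalf]
    _ ≤ |α| * (C / (1 + ‖y‖) ^ (k + 1) + 2 ^ k * C / (1 + ‖y‖) ^ (k + 1)) +
          (1 / 2) * (C / (1 + ‖y‖) ^ (k + 1)) + (1 / 2) * (2 ^ k * C / (1 + ‖y‖) ^ (k + 1)) +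
          3 * C / (1 + ‖y‖) ^ (k + 1) + 2 ^ k * C ^ 2 / (1 + ‖y‖) ^ (k + 1) +
          CP / (1 + ‖y‖) ^ (k + 1) := by
        gcongr
    _ = (|α| * (C + 2 ^ k * C) + (1 / 2) * C + (1 / 2) * (2 ^ k * C) + 3 * C + 2 ^ k * C ^ 2 + CP) /
          (1 + ‖y‖) ^ (k + 1) := by ring
    _ ≤ (1 + |α|) * ((2 ^ k + 4) * C + 2 ^ k * C ^ 2 + CP) / (1 + ‖y‖) ^ (k + 1) := by
        rw [div_le_div_iff_of_pos_right hwk]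
        have h2k : (1 : ℝ) ≤ 2 ^ k := one_le_pow₀ (by norm_num)
        nlinarith [mul_nonneg ha hC0, mul_nonneg ha hCP0, mul_nonneg ha (sq_nonneg C),
          mul_nonneg (mul_nonneg ha hC0) (sub_nonneg.2 h2k), mul_nonneg hC0 (sub_nonneg.2 h2k),
          pow_nonneg (zero_le_two (α := ℝ)) k, mul_nonneg ha (mul_nonneg (pow_nonneg (zero_le_two (α := ℝ)) k) (sq_nonneg C))]

end PineauVicol2026

end Literature.Analysis.FluidPDE
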